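import Summits.BirchSwinnertonDyer.BirchSwinnertonDyer.Theorems.EisensteinPrimesBSDpOnCellCStubC3ThmDShape
import Literature.NumberTheory.EllipticCurves.KellerYin2024.MultiplicativeReduction
import HarnessLib

/-!
# Crux 4 `BSDpOnCellC` (stmt-BirchSwinnertonDyer-19034), line b1 (v8 `ab3fba5c`; `stub_c3` verbatim v7),
# stub `stub_c3`: the RE-ORIENTED atoms c3♭′ / c3s♭′ FROM THE KELLER–YIN THEOREM-D BINDER BY NAME
# (cell `bsd-eis`, seat `bsd-eis-c3h` g3)

HONEST FRAMING (cell `bsd-eis`, run/shared/lean/pub/bsd-eis/): theorems only; nothing booked; X2 stays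
CONSTRUCTION-SHAPED; no label or count moves; BSD is not proved by any of this. Every theorem below is
CONDITIONAL on the explicit hypothesis
`(hD : KellerYin2024.thmD_imcMult_exists_isBDPLFunction_isTorsion_charIdeal_eq_OPEN)` — the tree's
transcription of Keller–Yin, arXiv:2402.12781v2, Thm. D (= Thm. 5.1.3; UNREFEREED PREPRINT, printed proof
gapped at L1754, flag `KYD-gap`) — taken BY NAME; nothing here asserts it.

## Why this file exists (seat memo `HOME/c3h-MEMO-2.md`; predecessor `HOME/c3h-MEMO-1.md`)

The registered conjuncts of `stub_c3` — c3♭ `X2.NonsplitIMCEqOnTreeInt W p` and c3s♭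
`X2.SplitIMCEqOnTreeInt W p` — assert, at every X2c Heegner datum `(K, 𝔭, ι', κ, γ, f)` with `𝔭` THE
prime of `K` above `p` induced by the embedding datum `ι'` and for every ♭-frame `Q` at `(ι', 𝔭)`
(`X11b.R1.IsBDPLFunctionInt p ι' 𝔭 κ γ f Ω_K Ω_p Q`), the equality
`X11b.R1.IMCEqIntAt W p κ 𝔭 γ Q`: `Ch_Λ(X_ac^∅(E[p^∞]) STRICT AT 𝔭)·𝓞_{ℂ_p}⟦T⟧ = (Q)`.
The Keller–Yin binder (and its published good-reduction sibling
`CastellaGrossiLeeSkinner2022.proofThm422_…`, and `X1.KellerYinIMC2Halves`) instead pair a frame at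
`(ι', v)` with `X_ac` STRICT AT THE OTHER PRIME `v̄`. Seat memo c3h-MEMO-1 (g2) showed the two typings
name complex-conjugate Selmer modules (characteristic ideals differing by `γ ↦ γ⁻¹`), so at most one is
faithful; seat memo c3h-MEMO-2 (g3) decides WHICH from the tree's own definitions (no print convention
enters): `X_ac` carries the PRECOMPOSITION action `T·x = x ∘ conj_γ − x` (`XAc.X_smul_apply`), so
`X_ac ⊗_{γ ↦ u}` is dual to `Sel[conj_γ = u]` and controls `Sel(K, E[p^∞] ⊗ ρ⁻¹)` for `ρ(γ) = u`; a
tree-frame at `(ι', 𝔭)` prescribes its values at `T = r_φ(γ) − 1` for `φ` of tree infinity type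
`(n)(−n)`, i.e. `φ_∞(z) = ι_w(z)^{−n} \overline{ι_w(z)}^{n}` (`HeckeCharacter.archFactor`), whose avatar
`r_φ` (`IsPAdicAvatarOf`: `r(Frob^geom) = ι'⁻¹ φ(ϖ)`) has Hodge–Tate weight `−n` at `𝔭`; hence the twist
`E[p^∞] ⊗ r_φ⁻¹` controlled at that point has weight `+n` at `𝔭`, and its Bloch–Kato condition is
RELAXED at `𝔭`, STRICT at `𝔭̄`. So the `Λ`-adic partner of a frame at `(ι', 𝔭)` is `X_ac` STRICT AT `𝔭̄`
— the binders' orientation (family B) — and the registered c3♭/c3s♭ (family A) state the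
`γ ↦ γ⁻¹`-CONJUGATE of that main conjecture (equal to it only where the characteristic ideal is
`ι`-invariant, an unprinted condition).

This file lands, BY NAME from the Keller–Yin binder, the two natural REPAIRS of the atoms, so that the
owner of -19034 can reshape `stub_c3` onto either and close it at the PRE tier immediately:

* form (a) — keep the frame at `(ι', 𝔭)`, move the strict prime of `X_ac` to `𝔭̄`:
  conclusion `X11b.R1.IMCEqIntAt W p κ 𝔭̄ γ Q` (`imcEqIntAt_other_of_thmD_OPEN`, generic over `K`;
  `nonsplitIMCEqIntAtOther_of_thmD_OPEN` / `splitIMCEqIntAtOther_of_thmD_OPEN` on the X2c data = the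
  binders of c3♭ / c3s♭ VERBATIM plus Keller–Yin's `Odd (discr K)`, `(p)` split, and the datum `𝔭̄`);
* form (b) — keep `X_ac` strict at `𝔭` (conclusion predicate `X11b.R1.IMCEqIntAt W p κ 𝔭 γ Q` LITERALLY
  that of c3♭), move the frame to `(ι'', 𝔭̄)` for an embedding datum `ι''` inducing `𝔭̄`
  (`imcEqIntAt_of_thmD_OPEN_of_frameOther`).

Both come with the `Λ`-torsion of the strict-at-the-other-prime `X_ac` (Keller–Yin's conjunct). Inputs:
the binder by name; `R₀ ⊆ 𝓞_{ℂ_p}` (`R1.imcEqIntAt_map`, `R1.isBDPLFunctionInt_map`); k5-c4's frame-ideal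
rigidity `X11b.R1.span_singleton_eq_of_isBDPLFunctionInt` (two ♭-frames of the same `(ι, 𝔮, κ, γ, f)`
generate one ideal); the identification of the Literature and Summits `X_ac`
(`charIdeal_literature_eq`, seat g2). No `μ/λ` input, no control theorem, no published fact beyond the
binder. What this is NOT: not a proof of Thm. D; not a proof of c3♭/c3s♭ AS REGISTERED (those are the
conjugate statements and are NOT implied); not an assertion about which convention print uses.

References: [KellerYin2024] Thm. D = Thm. 5.1.3, §0.1, §5.1 (arXiv:2402.12781v2 L233–L235, L306–L309,
L1725–L1780; PRE); [Castella2018] Def. 2.2, Thm. 3.1 (arXiv:1704.06608 pp. 5, 9);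
[CastellaHsieh2018] §3.3 (arXiv:1505.08165 p. 9); [CastellaGrossiLeeSkinner2022] §1.4, Thm. 2.1.1;
[BlochKato1990] §3 (the local conditions `H¹_f`); cell memos c3h MEMO-1 (g2), MEMO-2 (g3).
-/

set_option autoImplicit false
set_option linter.dupNamespace false

noncomputable section

open scoped Classical MatrixGroups ModularForm

open CongruenceSubgroup WeierstrassCurve NumberField IsDedekindDomain Field PowerSeries
  Literature.NumberTheory.EllipticCurves Literature.NumberTheory.EllipticCurves.GreenbergSelmer
  Literature.NumberTheory.EllipticCurves.ModularForms
  Literature.NumberTheory.EllipticCurves.Rank1Residual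
  Literature.NumberTheory.EllipticCurves.Rank1Residual.Typed
  Literature.NumberTheory.GaloisRepresentations Literature.NumberTheory.GaloisCohomology
  Literature.NumberTheory.Automorphic
  Summit.BirchSwinnertonDyer.Rank1Residual.X11b.AcSelmer
  Summit.BirchSwinnertonDyer.Rank1Residual.X11b.Halves
  Summit.BirchSwinnertonDyer.Rank1Residual.X11b
  Summit.BirchSwinnertonDyer.Rank1Residual.X2

namespace Summit.BirchSwinnertonDyer.BirchSwinnertonDyer.Theorems

/-! ### §1 The Keller–Yin binder, by name, over the wide receptacle — both orientations of the repair -/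

section Generic

variable {p : ℕ} [Fact p.Prime] {W : WeierstrassCurve ℚ} [W.IsElliptic] [W.IsGloballyMinimal]
  {K : Type} [Field K] [NumberField K] {N : ℕ} [NeZero N]
  {f : CuspForm (CongruenceSubgroup.Gamma0 N) 2}

/-- **Form (a): Keller–Yin Thm. D (PRE, by name) ⟹ `Λ`-torsion of `X_ac^∅` STRICT AT `𝔭̄` and
`Ch_Λ(X_ac^∅ strict at 𝔭̄)·𝓞_{ℂ_p}⟦T⟧ = (Q)` for EVERY ♭-frame `Q` at `(ι', 𝔭)`**, `𝔭` the prime induced by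
`ι'`, `𝔭̄ ∋ p` the other prime. Hypotheses: exactly the binder's (`f` the newform of the globally minimal
`W/ℚ`, level `N = N_W`, `2 < p`, `p ‖ N` i.e. `Mult`, `E[p]` reducible i.e. `Red`, `K` imaginary
quadratic with the Heegner hypothesis for `N`, `D_K` odd and `≠ −3`, `(p)` split, `ι'` inducing `𝔭`,
`p ∈ 𝔭̄ ≠ 𝔭`, `κ` anticyclotomic with topological generator `γ`) plus a ♭-frame `(Ω_K ≠ 0, Ω_p ≠ 0, Q)`
at `(ι', 𝔭)`. Proof: the binder gives an `R₀`-frame `L` at `(ι', 𝔭)` with the equality along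
`toUnr : ℤ_p → R₀`; read it in `𝓞_{ℂ_p}⟦T⟧` (`R1.imcEqIntAt_map`, `R1.isBDPLFunctionInt_map`) and move it to
`Q` by frame-ideal rigidity (`X11b.R1.span_singleton_eq_of_isBDPLFunctionInt`). This is the orientation
the binder PRINTS (`X_ac` relaxed at `v`, strict at `v̄`; frame at `v`); the registered c3♭ puts the strict
prime at `𝔭` instead and is NOT implied. CONDITIONAL on `hD`; nothing asserted.
[claim: KellerYin2024, status: under-review]
[cite: KellerYin2024, Thm. D = Thm. 5.1.3 and §5.1 (arXiv:2402.12781v2 L306–L309, L1725–L1780)]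
[cite: Castella2018, Def. 2.2 and Thm. 3.1 (arXiv:1704.06608 pp. 5, 9)] -/
theorem imcEqIntAt_other_of_thmD_OPEN
    (hD : KellerYin2024.thmD_imcMult_exists_isBDPLFunction_isTorsion_charIdeal_eq_OPEN)
    (ι' : PadicAlgCl p ≃+* ℂ) (𝔭 𝔭bar : HeightOneSpectrum (𝓞 K)) (κ : ZpExtension K p)
    (γ : Field.absoluteGaloisGroup K) [Fact (κ.IsTopGenerator γ)] (hfW : IsNewformOf W f)
    (hN : W.conductorNorm ℤ = N) (hp : 2 < p) (hmult : Mult W p) (hred : Red W p)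
    (hK : IsImaginaryQuadratic K) (hHN : SatisfiesHeegnerHypothesis N K)
    (hodd : Odd (NumberField.discr K)) (hd3 : NumberField.discr K ≠ -3)
    (hsplit : ((Ideal.span {(p : ℤ)}).primesOver (𝓞 K)).ncard = 2)
    (hι' : ∀ (w : InfinitePlace K) (k : 𝓞 K), k ∈ 𝔭.asIdeal ↔ ‖ι'.symm (w.embedding (k : K))‖ < 1)
    (h𝔭bar : ((p : ℕ) : 𝓞 K) ∈ 𝔭bar.asIdeal) (hne : 𝔭bar ≠ 𝔭) (hκ : κ.IsAnticyclotomic)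
    {ΩK : ℂ} {Ωp : ℂ_[p]} {Q : PowerSeries 𝓞_ℂ_[p]} (hΩK : ΩK ≠ 0) (hΩp : Ωp ≠ 0)
    (hQ : R1.IsBDPLFunctionInt p ι' 𝔭 κ γ f ΩK Ωp Q) :
    Module.IsTorsion (IwasawaAlgebra p) (XAc (W.baseChange K) p κ 𝔭bar ∅ γ) ∧
      R1.IMCEqIntAt W p κ 𝔭bar γ Q := by
  obtain ⟨ΩK', Ωp', L, hΩK', hL, hT, hEq⟩ :=
    hD ι' W K 𝔭 𝔭bar κ γ hfW hN hp hmult hred hK hHN hodd hd3 hsplit hι' h𝔭bar hne hκ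
  have hp2 : p ≠ 2 := by omega
  have hΩp' : ((Ωp' : unrIntegers p) : ℂ_[p]) ≠ 0 := by
    have h1 : ‖((Ωp' : unrIntegers p) : ℂ_[p])‖ = 1 := norm_coe_units_unrIntegers p Ωp'
    exact fun h0 ↦ by rw [h0, norm_zero] at h1; exact zero_ne_one h1
  have h3 : R1.IMCEqOnTreeAt W p κ 𝔭bar γ L := by
    unfold R1.IMCEqOnTreeAt
    rw [← charIdeal_literature_eq]
    exact hEq (toUnr p) (coe_toUnr p)
  refine ⟨hT, ?_⟩
  have h4 : R1.IMCEqIntAt W p κ 𝔭bar γ (PowerSeries.map (R1.unrToCpInt p) L) := R1.imcEqIntAt_map h3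
  unfold R1.IMCEqIntAt at h4 ⊢
  rw [h4]
  exact (R1.span_singleton_eq_of_isBDPLFunctionInt hp2 hK hκ (Fact.out : κ.IsTopGenerator γ) hΩK' hΩK
    hΩp' hΩp (R1.isBDPLFunctionInt_map hL) hQ).symm

/-- **Form (b): Keller–Yin Thm. D (PRE, by name) ⟹ `Λ`-torsion of `X_ac^∅` STRICT AT `𝔭` and
`X11b.R1.IMCEqIntAt W p κ 𝔭 γ Q` — LITERALLY the conclusion predicate of the registered c3♭ — for every
♭-frame `Q` at `(ι'', 𝔭̄)`, `ι''` an embedding datum inducing the OTHER prime `𝔭̄`.** The binder read at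
`(ι''; v := 𝔭̄, v̄ := 𝔭)`. Compared with c3♭ (frames at `(ι', 𝔭)` for the same `X_ac`), only the admitted
frames change: the frames at `(ι'', 𝔭̄)` are those of the `𝔭`-ADIC interpolation shape (positive
`𝔭`-adic weight, Euler-type factor at `𝔭̄`), which is the shape print pairs with `X_ac` relaxed at `𝔭̄`,
strict at `𝔭`. CONDITIONAL on `hD`; nothing asserted. [claim: KellerYin2024, status: under-review]
[cite: KellerYin2024, Thm. D = Thm. 5.1.3 and §5.1 (arXiv:2402.12781v2 L306–L309, L1725–L1780)]
[cite: CastellaHsieh2018, §3.3 and Prop. 3.6 (arXiv:1505.08165 pp. 9–11)] -/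
theorem imcEqIntAt_of_thmD_OPEN_of_frameOther
    (hD : KellerYin2024.thmD_imcMult_exists_isBDPLFunction_isTorsion_charIdeal_eq_OPEN)
    (ι'' : PadicAlgCl p ≃+* ℂ) (𝔭 𝔭bar : HeightOneSpectrum (𝓞 K)) (κ : ZpExtension K p)
    (γ : Field.absoluteGaloisGroup K) [Fact (κ.IsTopGenerator γ)] (hfW : IsNewformOf W f)
    (hN : W.conductorNorm ℤ = N) (hp : 2 < p) (hmult : Mult W p) (hred : Red W p)
    (hK : IsImaginaryQuadratic K) (hHN : SatisfiesHeegnerHypothesis N K)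
    (hodd : Odd (NumberField.discr K)) (hd3 : NumberField.discr K ≠ -3)
    (hsplit : ((Ideal.span {(p : ℤ)}).primesOver (𝓞 K)).ncard = 2)
    (hι'' : ∀ (w : InfinitePlace K) (k : 𝓞 K),
      k ∈ 𝔭bar.asIdeal ↔ ‖ι''.symm (w.embedding (k : K))‖ < 1)
    (h𝔭 : ((p : ℕ) : 𝓞 K) ∈ 𝔭.asIdeal) (hne : 𝔭 ≠ 𝔭bar) (hκ : κ.IsAnticyclotomic)
    {ΩK : ℂ} {Ωp : ℂ_[p]} {Q : PowerSeries 𝓞_ℂ_[p]} (hΩK : ΩK ≠ 0) (hΩp : Ωp ≠ 0)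
    (hQ : R1.IsBDPLFunctionInt p ι'' 𝔭bar κ γ f ΩK Ωp Q) :
    Module.IsTorsion (IwasawaAlgebra p) (XAc (W.baseChange K) p κ 𝔭 ∅ γ) ∧
      R1.IMCEqIntAt W p κ 𝔭 γ Q :=
  imcEqIntAt_other_of_thmD_OPEN hD ι'' 𝔭bar 𝔭 κ γ hfW hN hp hmult hred hK hHN hodd hd3 hsplit hι'' h𝔭
    hne hκ hΩK hΩp hQ

end Generic

/-! ### §2 The re-oriented X2c atoms c3♭′ / c3s♭′ (form (a)) from the binder, either sign -/

section Atoms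

variable {W : WeierstrassCurve ℚ} [W.IsElliptic] [W.IsGloballyMinimal] {p : ℕ} [Fact p.Prime]

/-- **c3♭′ — the re-oriented non-split atom, CLOSED BY NAME at the PRE tier.** Statement = the binders of
the registered c3♭ `X2.NonsplitIMCEqOnTreeInt W p` VERBATIM (CellC, `¬` split, `N = N_E`, `K` imaginary
quadratic with `D_K < −4`, Heegner hypothesis, `L(E^{D_K},1) ≠ 0`, a Heegner datum `P` with `p ∤ c` of
infinite order, `κ` anticyclotomic, `γ`, `𝔭 ∋ p` of degree one, the newform `f`, `ι'` inducing `𝔭`) with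
THREE insertions in Keller–Yin's currency — `Odd (discr K)` (KY §0.1 (disc); supplied in the b1
composition by `HoffsteinLuo1997_exists_twist_L_one_ne_zero`, `d ≡ 1 (mod 8)`), `(p)` split in `K`
(KY (spl)), and the other prime `𝔭̄ ∋ p`, `𝔭̄ ≠ 𝔭` — and the conclusion for every ♭-frame `Q` at
`(ι', 𝔭)`: `X11b.R1.IMCEqIntAt W p κ 𝔭̄ γ Q` (strict prime of `X_ac` at `𝔭̄`, NOT at `𝔭`). From
`imcEqIntAt_other_of_thmD_OPEN` (`2 < p`, `Mult`, `Red` from `CellC`; `D_K ≠ −3` from `D_K < −4`). The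
Heegner datum, the twisted `L`-value and the degree of `𝔭` are not used (kept so that the statement is the
registered atom's with insertions only). CONDITIONAL on `hD`; nothing asserted; not the registered c3♭.
[claim: KellerYin2024, status: under-review]
[cite: KellerYin2024, Thm. D = Thm. 5.1.3, §0.1 (arXiv:2402.12781v2 L233–L235, L306–L309)] -/
theorem nonsplitIMCEqIntAtOther_of_thmD_OPEN
    (hD : KellerYin2024.thmD_imcMult_exists_isBDPLFunction_isTorsion_charIdeal_eq_OPEN) :
    ∀ (N : ℕ) [NeZero N] (K : Type) [Field K] [NumberField K] (Dt : ModularParametrizationData W N)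
      (H : HeegnerDatum N (NumberField.discr K)) (ιK : K →+* ℂ) (P : (W.baseChange K).toAffine.Point),
      CellC W p → ¬ W.HasSplitMultiplicativeReductionAtPrime p → W.conductorNorm ℤ = N →
      IsImaginaryQuadratic K → NumberField.discr K < -4 → SatisfiesHeegnerHypothesis N K →
      (W.quadraticTwist (NumberField.discr K : ℚ)).entireLFunction 1 ≠ 0 →
      WeierstrassCurve.Affine.Point.map ιK.toRatAlgHom P = heegnerPointComplex Dt H →
      ¬ (p : ℤ) ∣ Dt.c → ¬ IsOfFinAddOrder P →
      Odd (NumberField.discr K) →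
      ∀ (κ : ZpExtension K p), κ.IsAnticyclotomic →
        ∀ (γ : Field.absoluteGaloisGroup K) [Fact (κ.IsTopGenerator γ)]
          (𝔭 : HeightOneSpectrum (𝓞 K)), ((p : ℕ) : 𝓞 K) ∈ 𝔭.asIdeal →
          𝔭.asIdeal.ramificationIdx (𝓞 ℚ) = 1 → 𝔭.asIdeal.inertiaDeg (𝓞 ℚ) = 1 →
          ∀ (𝔭bar : HeightOneSpectrum (𝓞 K)), ((p : ℕ) : 𝓞 K) ∈ 𝔭bar.asIdeal → 𝔭bar ≠ 𝔭 →
            ((Ideal.span {(p : ℤ)}).primesOver (𝓞 K)).ncard = 2 →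
          ∀ (f : CuspForm (CongruenceSubgroup.Gamma0 N) 2), IsNewformOf W f →
            ∀ (ι' : PadicAlgCl p ≃+* ℂ),
              (∀ (w : InfinitePlace K) (k : 𝓞 K),
                k ∈ 𝔭.asIdeal ↔ ‖ι'.symm (w.embedding (k : K))‖ < 1) →
              ∀ (ΩK : ℂ) (Ωp : ℂ_[p]) (Q : PowerSeries 𝓞_ℂ_[p]), ΩK ≠ 0 → ‖Ωp‖ = 1 →
                R1.IsBDPLFunctionInt p ι' 𝔭 κ γ f ΩK Ωp Q →
                  R1.IMCEqIntAt W p κ 𝔭bar γ Q := by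
  intro N _ K _ _ _ _ _ _ hc _ hN hK hd4 hHN _ _ _ _ hodd κ hκ γ _ 𝔭 _ _ _ 𝔭bar h𝔭bar hne hsplit f hfW
    ι' hι' ΩK Ωp Q hΩK hΩp hQ
  have hp : 2 < p := lt_of_le_of_ne (Fact.out : p.Prime).two_le (Ne.symm hc.2.1)
  have hd3 : NumberField.discr K ≠ -3 := by omega
  have hΩp0 : Ωp ≠ 0 := fun h0 ↦ by rw [h0, norm_zero] at hΩp; exact zero_ne_one hΩp
  exact (imcEqIntAt_other_of_thmD_OPEN hD ι' 𝔭 𝔭bar κ γ hfW hN hp hc.2.2.2 hc.2.2.1 hK hHN hodd hd3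
    hsplit hι' h𝔭bar hne hκ hΩK hΩp0 hQ).2

omit [W.IsElliptic] [W.IsGloballyMinimal] in
/-- **c3s♭′ — the re-oriented SPLIT atom, CLOSED BY NAME at the PRE tier** (Keller–Yin's Thm. D has no
sign hypothesis): the binders of the registered c3s♭ `X2.SplitIMCEqOnTreeInt W p` VERBATIM with the same
three insertions (`Odd (discr K)`, `(p)` split, `𝔭̄`), conclusion `X11b.R1.IMCEqIntAt W p κ 𝔭̄ γ Q` for
every ♭-frame `Q` at `(ι', 𝔭)`. CONDITIONAL on `hD`; nothing asserted; not the registered c3s♭.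
[claim: KellerYin2024, status: under-review]
[cite: KellerYin2024, Thm. D = Thm. 5.1.3, §0.1 (arXiv:2402.12781v2 L233–L235, L306–L309), no sign hypothesis] -/
theorem splitIMCEqIntAtOther_of_thmD_OPEN [W.IsElliptic] [W.IsGloballyMinimal]
    (hD : KellerYin2024.thmD_imcMult_exists_isBDPLFunction_isTorsion_charIdeal_eq_OPEN) :
    ∀ (N : ℕ) [NeZero N] (K : Type) [Field K] [NumberField K] (Dt : ModularParametrizationData W N)
      (H : HeegnerDatum N (NumberField.discr K)) (ιK : K →+* ℂ) (P : (W.baseChange K).toAffine.Point),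
      CellC W p → W.HasSplitMultiplicativeReductionAtPrime p → W.conductorNorm ℤ = N →
      IsImaginaryQuadratic K → NumberField.discr K < -4 → SatisfiesHeegnerHypothesis N K →
      (W.quadraticTwist (NumberField.discr K : ℚ)).entireLFunction 1 ≠ 0 →
      WeierstrassCurve.Affine.Point.map ιK.toRatAlgHom P = heegnerPointComplex Dt H →
      ¬ (p : ℤ) ∣ Dt.c → ¬ IsOfFinAddOrder P →
      Odd (NumberField.discr K) →
      ∀ (κ : ZpExtension K p), κ.IsAnticyclotomic →
        ∀ (γ : Field.absoluteGaloisGroup K) [Fact (κ.IsTopGenerator γ)]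
          (𝔭 : HeightOneSpectrum (𝓞 K)), ((p : ℕ) : 𝓞 K) ∈ 𝔭.asIdeal →
          𝔭.asIdeal.ramificationIdx (𝓞 ℚ) = 1 → 𝔭.asIdeal.inertiaDeg (𝓞 ℚ) = 1 →
          ∀ (𝔭bar : HeightOneSpectrum (𝓞 K)), ((p : ℕ) : 𝓞 K) ∈ 𝔭bar.asIdeal → 𝔭bar ≠ 𝔭 →
            ((Ideal.span {(p : ℤ)}).primesOver (𝓞 K)).ncard = 2 →
          ∀ (f : CuspForm (CongruenceSubgroup.Gamma0 N) 2), IsNewformOf W f →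
            ∀ (ι' : PadicAlgCl p ≃+* ℂ),
              (∀ (w : InfinitePlace K) (k : 𝓞 K),
                k ∈ 𝔭.asIdeal ↔ ‖ι'.symm (w.embedding (k : K))‖ < 1) →
              ∀ (ΩK : ℂ) (Ωp : ℂ_[p]) (Q : PowerSeries 𝓞_ℂ_[p]), ΩK ≠ 0 → ‖Ωp‖ = 1 →
                R1.IsBDPLFunctionInt p ι' 𝔭 κ γ f ΩK Ωp Q →
                  R1.IMCEqIntAt W p κ 𝔭bar γ Q := by
  intro N _ K _ _ _ _ _ _ hc _ hN hK hd4 hHN _ _ _ _ hodd κ hκ γ _ 𝔭 _ _ _ 𝔭bar h𝔭bar hne hsplit f hfW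
    ι' hι' ΩK Ωp Q hΩK hΩp hQ
  have hp : 2 < p := lt_of_le_of_ne (Fact.out : p.Prime).two_le (Ne.symm hc.2.1)
  have hd3 : NumberField.discr K ≠ -3 := by omega
  have hΩp0 : Ωp ≠ 0 := fun h0 ↦ by rw [h0, norm_zero] at hΩp; exact zero_ne_one hΩp
  exact (imcEqIntAt_other_of_thmD_OPEN hD ι' 𝔭 𝔭bar κ γ hfW hN hp hc.2.2.2 hc.2.2.1 hK hHN hodd hd3
    hsplit hι' h𝔭bar hne hκ hΩK hΩp0 hQ).2

/-- **The `Λ`-TORSION conjunct at the other prime, on the X2c data (either sign)**: under the binder,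
`X_ac^∅(E[p^∞])` STRICT AT `𝔭̄` is `Λ`-torsion at every X2c Heegner field with `D_K` odd and `(p)`
split — the control-theorem-free torsion input a reshaped `BSDpOnCellC_of` would consume next to c3♭′.
CONDITIONAL on `hD`; nothing asserted. [claim: KellerYin2024, status: under-review]
[cite: KellerYin2024, Thm. D = Thm. 5.1.3 (arXiv:2402.12781v2 L306–L309) ("`𝔛_f` … `Char`" of a torsion module, Lemma 5.1.1)] -/
theorem isTorsion_XAc_other_of_thmD_OPEN
    (hD : KellerYin2024.thmD_imcMult_exists_isBDPLFunction_isTorsion_charIdeal_eq_OPEN)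
    {N : ℕ} [NeZero N] {K : Type} [Field K] [NumberField K]
    {f : CuspForm (CongruenceSubgroup.Gamma0 N) 2} (hc : CellC W p) (hN : W.conductorNorm ℤ = N)
    (hK : IsImaginaryQuadratic K) (hd4 : NumberField.discr K < -4)
    (hHN : SatisfiesHeegnerHypothesis N K) (hodd : Odd (NumberField.discr K))
    (κ : ZpExtension K p) (hκ : κ.IsAnticyclotomic) (γ : Field.absoluteGaloisGroup K)
    [Fact (κ.IsTopGenerator γ)] (𝔭 𝔭bar : HeightOneSpectrum (𝓞 K))
    (h𝔭bar : ((p : ℕ) : 𝓞 K) ∈ 𝔭bar.asIdeal) (hne : 𝔭bar ≠ 𝔭)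
    (hsplit : ((Ideal.span {(p : ℤ)}).primesOver (𝓞 K)).ncard = 2) (hfW : IsNewformOf W f)
    (ι' : PadicAlgCl p ≃+* ℂ)
    (hι' : ∀ (w : InfinitePlace K) (k : 𝓞 K), k ∈ 𝔭.asIdeal ↔ ‖ι'.symm (w.embedding (k : K))‖ < 1) :
    Module.IsTorsion (IwasawaAlgebra p) (XAc (W.baseChange K) p κ 𝔭bar ∅ γ) := by
  have hp : 2 < p := lt_of_le_of_ne (Fact.out : p.Prime).two_le (Ne.symm hc.2.1)
  have hd3 : NumberField.discr K ≠ -3 := by omega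
  obtain ⟨_, _, _, -, -, hT, -⟩ :=
    hD ι' W K 𝔭 𝔭bar κ γ hfW hN hp hc.2.2.2 hc.2.2.1 hK hHN hodd hd3 hsplit hι' h𝔭bar hne hκ
  exact hT

end Atoms

end Summit.BirchSwinnertonDyer.BirchSwinnertonDyer.Theorems

end
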